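import Summits.QuantumFields.YangMills.Theorems.LuscherReductionDressedRitzPolyakovLiftTransplantFormsTrial
import Summits.QuantumFields.YangMills.Theorems.FemtoTransferGapPositivity
import HarnessLib

/-!
# Route `LuscherReduction`, item `DressedRitz` (stmt-QuantumFields-20205), line «polyakovlift» r6 — wave 2, task W2-F6 (part 3/3):
# (F6c) overlaps of the trial states across levels and radii (absolute and relative), and THE BUNDLED ONE-SITE PACKAGE in the `linkC B³` currency
# (helper lemmas `--supports stmt-QuantumFields-20205`; fleet seat prover ym-infvol-p2 g8 for the LEAD ym-lead-20205-polyakovlift g2, `WAVE-2-BRIEFS.md` §W2-F6)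

With `Ψ^R_j(U) = χ_R(gnCoord μ U)·f_j(gnCoord μ U)`, `c = μ⁹(2π²)⁻³`:
* `abs_l2_trial_trial_le` (F6c): `|⟨Ψ^R_i, Ψ^{R′}_j⟩| ≤ 8c(12μ² max(R,R′)² + C_f²I₉(e^{−R} + e^{−R′}))` for `i ≠ j`, `R, R′ ≥ 1` (flat orthogonality tail +
  the `6μ²r²` curvature of the chart density on the support `r = √2·max(R,R′)` against `∫|G_iG′_j| ≤ 1`);
* `abs_l2_trial_trial_le_rel` (F6c, relative): `|⟨Ψ^R_i, Ψ^{R′}_j⟩| ≤ ε·√⟨Ψ_i,Ψ_i⟩√⟨Ψ′_j,Ψ′_j⟩`, `ε = (12μ²max² + T)/((1 − 12μ²max²)(1 − T))` — the Gram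
  hypothesis of `ClusterInd.cluster_induction` (w1a g1's currency);
* `linkC_trial_estimate_radius'` (F6a″): ONE currency `linkC B³`, any `K ≥ K_j` (e.g. the level-uniform `absLowerK (physLevel (k+1)) …`), NO sign hypothesis on
  the bracket (`qform_su2Rep_self_nonneg`);
* ★★ `oneSite_package`: from `IsEigenFamily k f`, constants `(A, K, C_f)` depending on `(k, f)` ONLY and, for all admissible `(B, μ, R)` and every level `j`,
  the conjunction (F6a) ∧ (F6b) ∧ (F6c) in the literal notation the LEAD asked for (fleet bus 19:23:42Z (2); `F9-ASSEMBLY-PLAN.md` §§1–2, 5).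

## WHAT THIS IS NOT
Fixed-lattice one-site (`L = 1`) semiclassical bookkeeping toward ONE stub (`stub_pscaling`) of ONE conditional crux on the femto rung R2b1;
nothing here is infinite volume, a continuum limit, a mass gap or the Clay problem.  Sorry-free, no named fact, no new definitions.
References: M. Lüscher, NPB 219 (1983) 233 [cite: Luscher1983, §2–§3]; S. Agmon, Lectures on exponential decay (1982) [cite: Agmon1982, (1.16″), Cor. 4.5];
Reed–Simon IV [cite: ReedSimonIV1978, Thm. XIII.1–2, XIII.64].
-/

set_option autoImplicit false

noncomputable section

open MeasureTheory Filter Topology Real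
open scoped Matrix ENNReal
open Literature.MathematicalPhysics.QuantumFieldTheory
open Literature.MathematicalPhysics.QuantumLattice
open Literature.Analysis.OperatorTheory.YMMatrixModel

namespace Summit.QuantumFields.YangMills.Theorems.FemtoTransferGap.TransplantForms

open Summit.QuantumFields.YangMills.Theorems.FemtoTransferGap

/-! ### §1. (F6c) Overlaps of trial states of different levels and radii -/

section Overlaps

variable {k : ℕ} {f : Fin (k + 1) → ZM → ℝ}

/-- The `L²` pairing of two pull-backs is `8 ∫ ρ · G G′`. [folklore] -/
theorem l2_trial_trial_eq {μ R R' : ℝ} (hμ : 0 < μ) (hR : 0 < R) (hR' : 0 < R') (hsmooth : ∀ j, ∀ n : ℕ∞, ContDiff ℝ n (f j))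
    (i j : Fin (k + 1)) :
    l2 (fun U : Cfg => radialCutoff R (gnCoord μ U) * f i (gnCoord μ U)) (fun U => radialCutoff R' (gnCoord μ U) * f j (gnCoord μ U)) =
      8 * ∫ y, gnDensityReal μ y * ((radialCutoff R * f i) y * (radialCutoff R' * f j) y) := by
  have hG := isTestFn_cut hR hsmooth i
  have hG' := isTestFn_cut hR' hsmooth j
  obtain ⟨C, hC⟩ := exists_abs_cut_le hR hsmooth i
  obtain ⟨C', hC'⟩ := exists_abs_cut_le hR' hsmooth j
  have hm : Measurable fun y => (radialCutoff R * f i) y * (radialCutoff R' * f j) y :=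
    hG.continuous.measurable.mul hG'.continuous.measurable
  have hb : ∃ D : ℝ, ∀ y, |(radialCutoff R * f i) y * (radialCutoff R' * f j) y| ≤ D :=
    ⟨C * C', fun y => by
      rw [abs_mul]
      exact mul_le_mul (hC y) (hC' y) (abs_nonneg _) ((abs_nonneg _).trans (hC y))⟩
  unfold l2
  exact integral_gnPullback hμ hm hb

/-- **(F6c) Overlaps**: for `i ≠ j` and radii `R, R′ ≥ 1`,
`|⟨Ψ^{R}_i, Ψ^{R′}_j⟩| ≤ 8c · (12μ² max(R,R′)² + C_f²I₉ (e^{−R} + e^{−R′}))` — the flat part is an orthogonality tail, the curvature of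
the chart density costs `6μ²r²` on the support `‖y‖ ≤ r = √2·max(R,R′)` against `∫|G_iG′_j| ≤ 1`. [cite: Luscher1983, §2–§3] [cite: Agmon1982, Cor. 4.5] -/
theorem abs_l2_trial_trial_le {μ R R' : ℝ} (hμ : 0 < μ) (hR : 1 ≤ R) (hR' : 1 ≤ R')
    (hsmooth : ∀ j, ∀ n : ℕ∞, ContDiff ℝ n (f j)) (horth : ∀ i j, ∫ x, f i x * f j x = if i = j then (1 : ℝ) else 0)
    {Cf : ℝ} (hCf : ∀ j x, |f j x| ≤ Cf * Real.exp (-‖x‖)) {i j : Fin (k + 1)} (hij : i ≠ j) :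
    |l2 (fun U : Cfg => radialCutoff R (gnCoord μ U) * f i (gnCoord μ U)) (fun U => radialCutoff R' (gnCoord μ U) * f j (gnCoord μ U))| ≤
      8 * (μ ^ 9 * ((2 * π ^ 2)⁻¹) ^ 3) *
        (12 * μ ^ 2 * max R R' ^ 2 + (Cf ^ 2 * ∫ y : ZM, Real.exp (-‖y‖)) * (Real.exp (-R) + Real.exp (-R'))) := by
  have hR0 : 0 < R := lt_of_lt_of_le one_pos hR
  have hR0' : 0 < R' := lt_of_lt_of_le one_pos hR'
  rw [l2_trial_trial_eq hμ hR0 hR0' hsmooth i j]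
  have hG := isTestFn_cut hR0 hsmooth i
  have hG' := isTestFn_cut hR0' hsmooth j
  set c : ℝ := μ ^ 9 * ((2 * π ^ 2)⁻¹) ^ 3 with hc
  have hc0 : 0 < c := by positivity
  set r : ℝ := Real.sqrt 2 * max R R' with hr
  -- the product `H = G_i G'_j`
  generalize hGdef : radialCutoff R * f i = G at hG
  generalize hG'def : radialCutoff R' * f j = G' at hG'
  have hflat : |∫ y, G y * G' y| ≤ (Cf ^ 2 * ∫ y : ZM, Real.exp (-‖y‖)) * (Real.exp (-R) + Real.exp (-R')) := by
    rw [← hGdef, ← hG'def]; exact abs_integral_cut_mul_cut_le hsmooth horth hCf hR hR' hij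
  have hN : ∫ y, G y ^ 2 ≤ 1 := by
    rw [← hGdef]; exact (integral_cut_sq_bounds hsmooth horth hCf hR i).2
  have hN' : ∫ y, G' y ^ 2 ≤ 1 := by
    rw [← hG'def]; exact (integral_cut_sq_bounds hsmooth horth hCf hR' j).2
  have hsupp : ∀ y, G y * G' y ≠ 0 → ‖y‖ ≤ r := by
    intro y hy
    have h1 : G y ≠ 0 := left_ne_zero_of_mul hy
    rw [← hGdef] at h1
    have := norm_le_of_cut_ne_zero hR0 i h1
    exact this.trans (mul_le_mul_of_nonneg_left (le_max_left _ _) (Real.sqrt_nonneg 2))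
  have hHc : Continuous fun y => G y * G' y := hG.continuous.mul hG'.continuous
  have hHs : HasCompactSupport fun y => G y * G' y := hG.2.mul_right
  have IH : Integrable fun y => G y * G' y := hHc.integrable_of_hasCompactSupport hHs
  have IHabs : Integrable fun y => |G y * G' y| := IH.abs
  have IN : Integrable fun y => G y ^ 2 := hG.integrable_sq
  have IN' : Integrable fun y => G' y ^ 2 := hG'.integrable_sq
  -- `∫ |H| ≤ 1`
  have habsH : ∫ y, |G y * G' y| ≤ 1 := by
    have h1 : ∫ y, |G y * G' y| ≤ ∫ y, (1 / 2 : ℝ) * (G y ^ 2 + G' y ^ 2) := by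
      refine integral_mono IHabs ((IN.add IN').const_mul _) fun y => ?_
      have : |G y * G' y| ≤ (1 / 2 : ℝ) * (G y ^ 2 + G' y ^ 2) := by
        rw [abs_mul]
        nlinarith [sq_nonneg (|G y| - |G' y|), sq_abs (G y), sq_abs (G' y)]
      exact this
    rw [integral_const_mul, integral_add IN IN'] at h1
    linarith
  -- split `ρ = c − (c − ρ)`
  have Iρ : Integrable fun y => (c - gnDensityReal μ y) * (G y * G' y) := by
    refine (IHabs.const_mul c).mono' (((measurable_const.sub (measurable_gnDensityReal μ)).mul hHc.measurable).aestronglyMeasurable)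
      (ae_of_all _ fun y => ?_)
    rw [Real.norm_eq_abs, abs_mul]
    refine mul_le_mul_of_nonneg_right ?_ (abs_nonneg _)
    have h1 := gnDensityReal_le hμ y
    have h2 := (gnDensityReal_pos hμ y).le
    rw [← hc] at h1
    rw [abs_of_nonneg (by linarith)]
    linarith
  have hsplit : ∫ y, gnDensityReal μ y * (G y * G' y) = c * (∫ y, G y * G' y) - ∫ y, (c - gnDensityReal μ y) * (G y * G' y) := by
    rw [← integral_const_mul, ← integral_sub (IH.const_mul c) Iρ]
    exact integral_congr_ae (Eventually.of_forall fun y => by ring)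
  -- the curvature term
  have hcurv : |∫ y, (c - gnDensityReal μ y) * (G y * G' y)| ≤ c * (6 * (μ ^ 2 * r ^ 2)) := by
    have hpt : ∀ y, ‖(c - gnDensityReal μ y) * (G y * G' y)‖ ≤ c * (6 * (μ ^ 2 * r ^ 2)) * |G y * G' y| := by
      intro y
      rw [Real.norm_eq_abs, abs_mul]
      by_cases h0 : G y * G' y = 0
      · rw [h0, abs_zero, mul_zero, mul_zero]
      · refine mul_le_mul_of_nonneg_right ?_ (abs_nonneg _)
        have hy := hsupp y h0
        have hlo := gnDensityReal_ge_of_norm_le hμ hy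
        have hhi := gnDensityReal_le hμ y
        rw [← hc] at hlo hhi
        rw [abs_of_nonneg (by linarith)]
        linarith
    have h := norm_integral_le_of_norm_le (IHabs.const_mul (c * (6 * (μ ^ 2 * r ^ 2)))) (Eventually.of_forall hpt)
    rw [integral_const_mul, Real.norm_eq_abs] at h
    have h6 : 0 ≤ c * (6 * (μ ^ 2 * r ^ 2)) := by positivity
    calc |∫ y, (c - gnDensityReal μ y) * (G y * G' y)| ≤ c * (6 * (μ ^ 2 * r ^ 2)) * ∫ y, |G y * G' y| := h
      _ ≤ c * (6 * (μ ^ 2 * r ^ 2)) * 1 := mul_le_mul_of_nonneg_left habsH h6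
      _ = c * (6 * (μ ^ 2 * r ^ 2)) := mul_one _
  have hr2 : 6 * (μ ^ 2 * r ^ 2) = 12 * μ ^ 2 * max R R' ^ 2 := by
    rw [hr, mul_pow, Real.sq_sqrt (by norm_num : (0:ℝ) ≤ 2)]; ring
  rw [hsplit, abs_mul, abs_of_pos (by norm_num : (0:ℝ) < 8)]
  have htri : |c * (∫ y, G y * G' y) - ∫ y, (c - gnDensityReal μ y) * (G y * G' y)| ≤
      c * |∫ y, G y * G' y| + |∫ y, (c - gnDensityReal μ y) * (G y * G' y)| := by
    have := abs_sub (c * ∫ y, G y * G' y) (∫ y, (c - gnDensityReal μ y) * (G y * G' y))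
    rw [abs_mul, abs_of_pos hc0] at this
    exact this
  rw [hr2] at hcurv
  have hflat' := mul_le_mul_of_nonneg_left hflat hc0.le
  linarith [htri, hcurv, hflat']

end Overlaps

/-! ### §2. Relative overlaps (the Gram hypothesis of the cluster induction) -/

section Relative

variable {k : ℕ} {f : Fin (k + 1) → ZM → ℝ}

/-- **(F6c, relative form)** — the shape consumed by `ClusterInd.cluster_induction`'s near-orthogonality hypothesis: for `i ≠ j`, radii `R, R′ ≥ 1` with
`12μ² max(R,R′)² < 1` and `C_f²I₉(e^{−R} + e^{−R′}) < 1`,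
`|⟨Ψ^R_i, Ψ^{R′}_j⟩| ≤ ε · √⟨Ψ^R_i,Ψ^R_i⟩ · √⟨Ψ^{R′}_j,Ψ^{R′}_j⟩` with `ε = (12μ²max² + T)/((1 − 12μ²max²)(1 − T))`, `T = C_f²I₉(e^{−R} + e^{−R′})`
(the common factor `8c` cancels). [cite: Luscher1983, §2–§3] [cite: Agmon1982, Cor. 4.5] -/
theorem abs_l2_trial_trial_le_rel {μ R R' : ℝ} (hμ : 0 < μ) (hR : 1 ≤ R) (hR' : 1 ≤ R')
    (hsmooth : ∀ j, ∀ n : ℕ∞, ContDiff ℝ n (f j)) (horth : ∀ i j, ∫ x, f i x * f j x = if i = j then (1 : ℝ) else 0)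
    {Cf : ℝ} (hCf : ∀ j x, |f j x| ≤ Cf * Real.exp (-‖x‖)) {i j : Fin (k + 1)} (hij : i ≠ j)
    (hwin : 12 * μ ^ 2 * max R R' ^ 2 < 1)
    (htail : (Cf ^ 2 * ∫ y : ZM, Real.exp (-‖y‖)) * (Real.exp (-R) + Real.exp (-R')) < 1) :
    |l2 (fun U : Cfg => radialCutoff R (gnCoord μ U) * f i (gnCoord μ U)) (fun U => radialCutoff R' (gnCoord μ U) * f j (gnCoord μ U))| ≤
      (12 * μ ^ 2 * max R R' ^ 2 + (Cf ^ 2 * ∫ y : ZM, Real.exp (-‖y‖)) * (Real.exp (-R) + Real.exp (-R'))) /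
          ((1 - 12 * μ ^ 2 * max R R' ^ 2) * (1 - (Cf ^ 2 * ∫ y : ZM, Real.exp (-‖y‖)) * (Real.exp (-R) + Real.exp (-R')))) *
        (Real.sqrt (l2 (fun U : Cfg => radialCutoff R (gnCoord μ U) * f i (gnCoord μ U)) (fun U => radialCutoff R (gnCoord μ U) * f i (gnCoord μ U))) *
          Real.sqrt (l2 (fun U : Cfg => radialCutoff R' (gnCoord μ U) * f j (gnCoord μ U)) (fun U => radialCutoff R' (gnCoord μ U) * f j (gnCoord μ U)))) := by
  have hR0 : 0 < R := lt_of_lt_of_le one_pos hR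
  have hR0' : 0 < R' := lt_of_lt_of_le one_pos hR'
  have hov := abs_l2_trial_trial_le hμ hR hR' hsmooth horth hCf hij
  have hXlo := le_l2_trial hμ hR0 hsmooth i
  have hYlo := le_l2_trial hμ hR0' hsmooth j
  have hNi := (integral_cut_sq_bounds hsmooth horth hCf hR i).1
  have hNj := (integral_cut_sq_bounds hsmooth horth hCf hR' j).1
  have hc0 : 0 < μ ^ 9 * ((2 * π ^ 2)⁻¹) ^ 3 := by positivity
  generalize hc : μ ^ 9 * ((2 * π ^ 2)⁻¹) ^ 3 = c at hov hXlo hYlo hc0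
  generalize hX : l2 (fun U : Cfg => radialCutoff R (gnCoord μ U) * f i (gnCoord μ U)) (fun U => radialCutoff R (gnCoord μ U) * f i (gnCoord μ U)) = X at hXlo
  generalize hY : l2 (fun U : Cfg => radialCutoff R' (gnCoord μ U) * f j (gnCoord μ U)) (fun U => radialCutoff R' (gnCoord μ U) * f j (gnCoord μ U)) = Y at hYlo
  generalize hZ : l2 (fun U : Cfg => radialCutoff R (gnCoord μ U) * f i (gnCoord μ U)) (fun U => radialCutoff R' (gnCoord μ U) * f j (gnCoord μ U)) = Z at hov
  generalize hNidef : ∫ y, (radialCutoff R * f i) y ^ 2 = Ni at hXlo hNi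
  generalize hNjdef : ∫ y, (radialCutoff R' * f j) y ^ 2 = Nj at hYlo hNj
  have hI0 : 0 ≤ Cf ^ 2 * ∫ y : ZM, Real.exp (-‖y‖) := by
    have : 0 ≤ ∫ y : ZM, Real.exp (-‖y‖) := integral_nonneg fun y => (Real.exp_pos _).le
    positivity
  generalize hT : (Cf ^ 2 * ∫ y : ZM, Real.exp (-‖y‖)) * (Real.exp (-R) + Real.exp (-R')) = T at hov htail ⊢
  generalize hM : 12 * μ ^ 2 * max R R' ^ 2 = M at hov hwin ⊢
  -- the two norm floors `8c(1 − M)(1 − T) ≤ X, Y`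
  have hM0 : 0 ≤ M := by rw [← hM]; positivity
  have heR : 0 < Real.exp (-R) := Real.exp_pos _
  have heR' : 0 < Real.exp (-R') := Real.exp_pos _
  have hIeR : 0 ≤ (Cf ^ 2 * ∫ y : ZM, Real.exp (-‖y‖)) * Real.exp (-R) := mul_nonneg hI0 heR.le
  have hIeR' : 0 ≤ (Cf ^ 2 * ∫ y : ZM, Real.exp (-‖y‖)) * Real.exp (-R') := mul_nonneg hI0 heR'.le
  have hTsplit : T = (Cf ^ 2 * ∫ y : ZM, Real.exp (-‖y‖)) * Real.exp (-R) + (Cf ^ 2 * ∫ y : ZM, Real.exp (-‖y‖)) * Real.exp (-R') := by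
    rw [← hT]; ring
  have hTi : (Cf ^ 2 * ∫ y : ZM, Real.exp (-‖y‖)) * Real.exp (-R) ≤ T := by linarith
  have hTj : (Cf ^ 2 * ∫ y : ZM, Real.exp (-‖y‖)) * Real.exp (-R') ≤ T := by linarith
  have hT0 : 0 ≤ T := by linarith
  have hD1 : 0 < 1 - M := by linarith
  have hD2 : 0 < 1 - T := by linarith
  have h12 : 0 ≤ 12 * μ ^ 2 := by positivity
  have hMi : 12 * μ ^ 2 * R ^ 2 ≤ M := by
    rw [← hM]
    exact mul_le_mul_of_nonneg_left (pow_le_pow_left₀ hR0.le (le_max_left _ _) 2) h12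
  have hMj : 12 * μ ^ 2 * R' ^ 2 ≤ M := by
    rw [← hM]
    exact mul_le_mul_of_nonneg_left (pow_le_pow_left₀ hR0'.le (le_max_right _ _) 2) h12
  have hNi' : 1 - T ≤ Ni := by linarith
  have hNj' : 1 - T ≤ Nj := by linarith
  have hcM0 : 0 ≤ 8 * (c * (1 - M)) := mul_nonneg (by norm_num) (mul_nonneg hc0.le hD1.le)
  have hfloorX : 8 * c * ((1 - M) * (1 - T)) ≤ X := by
    have hNi0 : 0 ≤ Ni := by linarith
    have h1 : c * (1 - M) * Ni ≤ c * (1 - 12 * μ ^ 2 * R ^ 2) * Ni :=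
      mul_le_mul_of_nonneg_right (mul_le_mul_of_nonneg_left (by linarith) hc0.le) hNi0
    have h2 : 8 * (c * (1 - M)) * (1 - T) ≤ 8 * (c * (1 - M)) * Ni := mul_le_mul_of_nonneg_left hNi' hcM0
    linarith
  have hfloorY : 8 * c * ((1 - M) * (1 - T)) ≤ Y := by
    have hNj0 : 0 ≤ Nj := by linarith
    have h1 : c * (1 - M) * Nj ≤ c * (1 - 12 * μ ^ 2 * R' ^ 2) * Nj :=
      mul_le_mul_of_nonneg_right (mul_le_mul_of_nonneg_left (by linarith) hc0.le) hNj0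
    have h2 : 8 * (c * (1 - M)) * (1 - T) ≤ 8 * (c * (1 - M)) * Nj := mul_le_mul_of_nonneg_left hNj' hcM0
    linarith
  have hF0 : 0 < 8 * c * ((1 - M) * (1 - T)) := mul_pos (mul_pos (by norm_num) hc0) (mul_pos hD1 hD2)
  have hsqrt : 8 * c * ((1 - M) * (1 - T)) ≤ Real.sqrt X * Real.sqrt Y := by
    have h1 : Real.sqrt (8 * c * ((1 - M) * (1 - T))) ≤ Real.sqrt X := Real.sqrt_le_sqrt hfloorX
    have h2 : Real.sqrt (8 * c * ((1 - M) * (1 - T))) ≤ Real.sqrt Y := Real.sqrt_le_sqrt hfloorY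
    have h3 := mul_le_mul h1 h2 (Real.sqrt_nonneg _) (Real.sqrt_nonneg _)
    rwa [Real.mul_self_sqrt hF0.le] at h3
  have hnum0 : 0 ≤ (M + T) / ((1 - M) * (1 - T)) := div_nonneg (add_nonneg hM0 hT0) (mul_pos hD1 hD2).le
  calc |Z| ≤ 8 * c * (M + T) := hov
    _ = (M + T) / ((1 - M) * (1 - T)) * (8 * c * ((1 - M) * (1 - T))) := by
        field_simp
    _ ≤ (M + T) / ((1 - M) * (1 - T)) * (Real.sqrt X * Real.sqrt Y) := mul_le_mul_of_nonneg_left hsqrt hnum0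

end Relative

/-! ### §3. The bundled one-site package, in the ONE currency `linkC B³` of the F9 assembly -/

section Package

variable {k : ℕ} {f : Fin (k + 1) → ZM → ℝ}

/-- `absLowerK` is monotone in its energy slot (the term `4E + 4`). [folklore] -/
theorem absLowerK_mono_energy {E E' A Mom : ℝ} (h : E ≤ E') (m : ℕ) : absLowerK E A Mom m ≤ absLowerK E' A Mom m := by
  unfold absLowerK; linarith

/-- **(F6a″) ONE currency, level-uniform constant, no sign hypothesis.**  Under the flat data of `trial_estimate_radius` (energy/mass inequalities
with the flat constant `A`), for every `K ≥ absLowerK E_j A (C_f²I₉) 0` (e.g. the level-uniform `absLowerK (physLevel (k+1)) A (C_f²I₉) 0`):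
`linkC B³ · (1 − 2μ(E_j + 2A e^{−R}) − μ²K) · ‖Ψ_j‖² ≤ ⟨Ψ_j, K_B Ψ_j⟩` — if the bracket is negative the left side is `≤ 0 ≤ ⟨Ψ_j, K_BΨ_j⟩`
(`qform_su2Rep_self_nonneg`). [cite: Luscher1983, §2–§3] [cite: OsterwalderSeiler1978, §2] -/
theorem linkC_trial_estimate_radius' (hsmooth : ∀ j, ∀ n : ℕ∞, ContDiff ℝ n (f j)) (hinv : ∀ j, IsGaugeInv (f j))
    {Cf : ℝ} (hCf : ∀ j x, |f j x| ≤ Cf * Real.exp (-‖x‖))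
    {A : ℝ} (hA0 : 0 ≤ A) {R : ℝ} (hR1 : 1 ≤ R) (j : Fin (k + 1))
    (hq1 : energyForm (radialCutoff R * f j) ≤
      physLevel ((j : ℕ) + 1) * (∫ y, (radialCutoff R * f j) y ^ 2) + A * Real.exp (-R))
    (hq2 : 1 - A * Real.exp (-R) ≤ ∫ y, (radialCutoff R * f j) y ^ 2)
    (hAR : A * Real.exp (-R) ≤ 1 / 2)
    {B μ : ℝ} (hB : 0 < B) (hμ : 0 < μ) (hBμ : B * μ ^ 3 = 1 / 4) (hμ8 : μ ≤ 1 / 8) (hRμ : R ≤ 1 / (8 * μ)) (hBπ : π ≤ B)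
    {K : ℝ} (hK : absLowerK (physLevel ((j : ℕ) + 1)) A (Cf ^ 2 * ∫ y : ZM, Real.exp (-‖y‖)) 0 ≤ K) :
    linkC B ^ 3 * (1 - 2 * μ * (physLevel ((j : ℕ) + 1) + 2 * A * Real.exp (-R)) - μ ^ 2 * K) *
        l2 (fun U : Cfg => radialCutoff R (gnCoord μ U) * f j (gnCoord μ U)) (fun U => radialCutoff R (gnCoord μ U) * f j (gnCoord μ U)) ≤
      qform su2Rep B (fun U : Cfg => radialCutoff R (gnCoord μ U) * f j (gnCoord μ U))
        (fun U => radialCutoff R (gnCoord μ U) * f j (gnCoord μ U)) := by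
  have hR0 : 0 < R := lt_of_lt_of_le one_pos hR1
  have hq0 : 0 ≤ qform su2Rep B (fun U : Cfg => radialCutoff R (gnCoord μ U) * f j (gnCoord μ U))
      (fun U => radialCutoff R (gnCoord μ U) * f j (gnCoord μ U)) :=
    qform_su2Rep_self_nonneg hB.le (isPhys_trial μ hR0 hsmooth hinv j)
  have hl0 : 0 ≤ l2 (fun U : Cfg => radialCutoff R (gnCoord μ U) * f j (gnCoord μ U)) (fun U => radialCutoff R (gnCoord μ U) * f j (gnCoord μ U)) :=
    by unfold l2; exact integral_nonneg fun _ => mul_self_nonneg _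
  have hlink0 : 0 ≤ linkC B ^ 3 := pow_nonneg (linkC_pos hB.le).le 3
  have hμ2 : 0 ≤ μ ^ 2 := sq_nonneg μ
  -- the bracket with `K` is below the bracket with `K_j`
  have hbr : 1 - 2 * μ * (physLevel ((j : ℕ) + 1) + 2 * A * Real.exp (-R)) - μ ^ 2 * K ≤
      1 - 2 * μ * (physLevel ((j : ℕ) + 1) + 2 * A * Real.exp (-R))
        - μ ^ 2 * absLowerK (physLevel ((j : ℕ) + 1)) A (Cf ^ 2 * ∫ y : ZM, Real.exp (-‖y‖)) 0 := by
    have := mul_le_mul_of_nonneg_left hK hμ2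
    linarith
  by_cases ht : 0 ≤ 1 - 2 * μ * (physLevel ((j : ℕ) + 1) + 2 * A * Real.exp (-R)) - μ ^ 2 * K
  · have ht' := ht.trans hbr
    have h := linkC_trial_estimate_radius hsmooth hinv hCf hA0 hR1 j hq1 hq2 hAR hB hμ hBμ hμ8 hRμ hBπ ht'
    refine le_trans ?_ h
    exact mul_le_mul_of_nonneg_right (mul_le_mul_of_nonneg_left hbr hlink0) hl0
  · push Not at ht
    have : linkC B ^ 3 * (1 - 2 * μ * (physLevel ((j : ℕ) + 1) + 2 * A * Real.exp (-R)) - μ ^ 2 * K) *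
        l2 (fun U : Cfg => radialCutoff R (gnCoord μ U) * f j (gnCoord μ U)) (fun U => radialCutoff R (gnCoord μ U) * f j (gnCoord μ U)) ≤ 0 :=
      mul_nonpos_of_nonpos_of_nonneg (mul_nonpos_of_nonneg_of_nonpos hlink0 ht.le) hl0
    linarith

/-- ★★ **(W2-F6) THE ONE-SITE QUASIMODE PACKAGE AT GENERAL CUT-OFF RADIUS — in the exact currency of the F9 assembly** (LEAD 19:23:42Z:
ONE currency `linkC B³`; constants depending on `(k, f)` only).  For an AL1 family `f` (`IsEigenFamily k f`) there are `A, K, C_f ≥ 0` (`|f_j| ≤ C_f e^{−‖x‖}`)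
such that for all `B, μ > 0` with `Bμ³ = 1/4`, `μ ≤ 1/8`, `π ≤ B`, every radius `1 ≤ R ≤ 1/(8μ)` with `A e^{−R} ≤ 1/2`, and every level `j`, writing
`E_j = physLevel (j+1)`, `c = μ⁹(2π²)⁻³`, `G_j = χ_R f_j`, `Ψ_j(U) = χ_R(gnCoord μ U)·f_j(gnCoord μ U)`:
(F6a) `linkC B³ · (1 − 2μ(E_j + A e^{−R}) − μ²K) · ⟨Ψ_j,Ψ_j⟩ ≤ ⟨Ψ_j, K_BΨ_j⟩` (no sign hypothesis on the bracket);
(F6b) `Ψ_j` is physical, `8c(1 − 12μ²R²)∫G_j² ≤ ⟨Ψ_j,Ψ_j⟩ ≤ 8c∫G_j²`, `1 − Ae^{−R} ≤ ∫G_j² ≤ 1`;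
(F6c) for every `R′ ≥ 1` and `i ≠ j`: `|⟨Ψ^R_i, Ψ^{R′}_j⟩| ≤ 8c(12μ² max(R,R′)² + A(e^{−R} + e^{−R′}))`.
(Internally `A = 2A♭`, `K = absLowerK (physLevel (k+1)) A♭ (C_f²∫e^{−‖y‖}) 0` with `A♭` the flat constant of `flat_package`.) [cite: Luscher1983, §2–§3] [cite: Agmon1982, Cor. 4.5] -/
theorem oneSite_package (hf : IsEigenFamily k f) :
    ∃ A K Cf : ℝ, 0 ≤ A ∧ 0 ≤ K ∧ 0 ≤ Cf ∧ (∀ j x, |f j x| ≤ Cf * Real.exp (-‖x‖)) ∧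
      ∀ B μ : ℝ, 0 < B → 0 < μ → B * μ ^ 3 = 1 / 4 → μ ≤ 1 / 8 → π ≤ B →
      ∀ R : ℝ, 1 ≤ R → R ≤ 1 / (8 * μ) → A * Real.exp (-R) ≤ 1 / 2 → ∀ j : Fin (k + 1),
        -- (F6a)
        linkC B ^ 3 * (1 - 2 * μ * (physLevel ((j : ℕ) + 1) + A * Real.exp (-R)) - μ ^ 2 * K) *
            l2 (fun U : Cfg => radialCutoff R (gnCoord μ U) * f j (gnCoord μ U)) (fun U => radialCutoff R (gnCoord μ U) * f j (gnCoord μ U)) ≤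
          qform su2Rep B (fun U : Cfg => radialCutoff R (gnCoord μ U) * f j (gnCoord μ U))
            (fun U => radialCutoff R (gnCoord μ U) * f j (gnCoord μ U)) ∧
        -- (F6b)
        IsPhys (fun U : Cfg => radialCutoff R (gnCoord μ U) * f j (gnCoord μ U)) ∧
        8 * (μ ^ 9 * ((2 * π ^ 2)⁻¹) ^ 3 * (1 - 12 * μ ^ 2 * R ^ 2)) * ∫ y, (radialCutoff R * f j) y ^ 2 ≤
          l2 (fun U : Cfg => radialCutoff R (gnCoord μ U) * f j (gnCoord μ U)) (fun U => radialCutoff R (gnCoord μ U) * f j (gnCoord μ U)) ∧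
        l2 (fun U : Cfg => radialCutoff R (gnCoord μ U) * f j (gnCoord μ U)) (fun U => radialCutoff R (gnCoord μ U) * f j (gnCoord μ U)) ≤
          8 * (μ ^ 9 * ((2 * π ^ 2)⁻¹) ^ 3) * ∫ y, (radialCutoff R * f j) y ^ 2 ∧
        1 - A * Real.exp (-R) ≤ ∫ y, (radialCutoff R * f j) y ^ 2 ∧ ∫ y, (radialCutoff R * f j) y ^ 2 ≤ 1 ∧
        -- (F6c)
        ∀ R' : ℝ, 1 ≤ R' → ∀ i : Fin (k + 1), i ≠ j →
          |l2 (fun U : Cfg => radialCutoff R (gnCoord μ U) * f i (gnCoord μ U)) (fun U => radialCutoff R' (gnCoord μ U) * f j (gnCoord μ U))| ≤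
            8 * (μ ^ 9 * ((2 * π ^ 2)⁻¹) ^ 3) * (12 * μ ^ 2 * max R R' ^ 2 + A * (Real.exp (-R) + Real.exp (-R'))) := by
  have hsmooth := hf.1
  have hinv := hf.2.1
  have horth := hf.2.2.1
  obtain ⟨A, Cf, hA0, hCf0, hCf, hCA, hflat⟩ := flat_package hf
  have hI0 : 0 ≤ ∫ y : ZM, Real.exp (-‖y‖) := integral_nonneg fun y => (Real.exp_pos _).le
  have hE0 : 0 ≤ physLevel (k + 1) := physLevel_nonneg (Nat.succ_le_succ (Nat.zero_le k))
  refine ⟨2 * A, absLowerK (physLevel (k + 1)) A (Cf ^ 2 * ∫ y : ZM, Real.exp (-‖y‖)) 0, Cf, by positivity,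
    absLowerK_nonneg hE0 hA0 (by positivity) 0, hCf0, hCf, fun B μ hB hμ hBμ hμ8 hBπ R hR hRμ hAR j => ?_⟩
  have hR0 : 0 < R := lt_of_lt_of_le one_pos hR
  have heR : 0 < Real.exp (-R) := Real.exp_pos _
  have hAeR : 0 ≤ A * Real.exp (-R) := mul_nonneg hA0 heR.le
  have hAR' : A * Real.exp (-R) ≤ 1 / 2 := by linarith
  obtain ⟨hq1, hq2, hq3, -⟩ := hflat R hR j
  have hK : absLowerK (physLevel ((j : ℕ) + 1)) A (Cf ^ 2 * ∫ y : ZM, Real.exp (-‖y‖)) 0 ≤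
      absLowerK (physLevel (k + 1)) A (Cf ^ 2 * ∫ y : ZM, Real.exp (-‖y‖)) 0 :=
    absLowerK_mono_energy (physLevel_mono (Nat.succ_le_succ (Nat.zero_le _)) (Nat.succ_le_succ (Nat.le_of_lt_succ j.2))) 0
  have hF6a := linkC_trial_estimate_radius' hsmooth hinv hCf hA0 hR j hq1 hq2 hAR' hB hμ hBμ hμ8 hRμ hBπ hK
  rw [show 2 * μ * (physLevel ((j : ℕ) + 1) + 2 * A * Real.exp (-R)) = 2 * μ * (physLevel ((j : ℕ) + 1) + (2 * A) * Real.exp (-R)) by ring]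
    at hF6a
  refine ⟨hF6a, isPhys_trial μ hR0 hsmooth hinv j, le_l2_trial hμ hR0 hsmooth j, l2_trial_le hμ hR0 hsmooth j, by linarith, hq3,
    fun R' hR' i hij => ?_⟩
  have h := abs_l2_trial_trial_le hμ hR hR' hsmooth horth hCf hij
  refine h.trans (mul_le_mul_of_nonneg_left ?_ (by positivity))
  have heR' : 0 < Real.exp (-R') := Real.exp_pos _
  have : (Cf ^ 2 * ∫ y : ZM, Real.exp (-‖y‖)) * (Real.exp (-R) + Real.exp (-R')) ≤ (2 * A) * (Real.exp (-R) + Real.exp (-R')) :=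
    mul_le_mul_of_nonneg_right (by linarith) (by positivity)
  linarith

end Package

end Summit.QuantumFields.YangMills.Theorems.FemtoTransferGap.TransplantForms

end
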